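import Literature.Computability.AlgebraicComplexity.DeterminantIrreducible
import Mathlib.Algebra.MvPolynomial.Funext
import Mathlib.Algebra.MvPolynomial.Equiv
import Mathlib.RingTheory.Polynomial.ScaleRoots
import Mathlib.Algebra.Polynomial.Div
import HarnessLib

/-!
# A polynomial vanishing on the singular matrices is divisible by the determinant

Topic `Literature/Computability/AlgebraicComplexity`, companion of `DeterminantIrreducible.lean`.
Over an infinite field `k`, let `ι : (d+1) × (d+1) ↪ α` place a square matrix of distinct variables
`Y = (x_{ι(i,j)})` inside the polynomial ring `k[x_α]` (possibly with further variables), and let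
`P ∈ k[x_α]` vanish at every point of `k^α` whose `Y`-matrix is singular. Then `det Y ∣ P`
(`det_dvd_of_forall_eval_eq_zero`).

This is the algebraic form of "`{det = 0}` is a reduced irreducible hypersurface" used without the
Nullstellensatz and without algebraic closure: expand `det Y = y₀ C + E` along the first row
(`y₀ = x_{ι(0,0)}`, `C` the cofactor, `C, E` free of `y₀`), read `P` as a polynomial `p(y₀)` over
`R = k[x_β]`, `β = α ∖ {y₀}` (`MvPolynomial.optionEquivLeft`), and put `H = p.scaleRoots C`, so that
`H(C y₀) = C^N p(y₀)`. At a point `z` with `C(z) ≠ 0` the value `y₀ = -E(z)/C(z)` makes `Y` singular,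
whence `p_z(-E(z)/C(z)) = 0` and `H(-E)(z) = 0`; so `H(-E) · C` vanishes identically, `H(-E) = 0`
(`MvPolynomial.funext`, `k` infinite), `(y₀ + E) ∣ H` (factor theorem), and substituting `y₀ ↦ C y₀`
gives `det Y ∣ C^N P`. Since `det Y` is prime (`prime_det_of_X`) and does not divide `C` (degree in
`y₀`), `det Y ∣ P`.

It is used in `Literature/NumberTheory/DiophantineGeometry/KroneckerRectangularStability.lean`
(Manivel's stability of rectangular Kronecker coefficients: an invariant triple highest-weight form
vanishing on the singular top matrices is divisible by the top determinant).

## References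

* N. Jacobson, *Basic Algebra I*, 2nd ed. (1985), §7.2 (`det (x_{ij})` is prime). [folklore]

## Mathlib

`MvPolynomial.optionEquivLeft` (`optionEquivLeft_X_none/X_some`, `optionEquivLeft_elim_eval`),
`Equiv.optionSubtypeNe`, `Polynomial.scaleRoots` (`scaleRoots_eval₂_mul`), `Polynomial.dvd_iff_isRoot`,
`Matrix.det_succ_row_zero`, `MvPolynomial.funext`, `MvPolynomial.degreeOf_mul_eq`,
`MvPolynomial.mem_vars_rename`, `coeff_rename_mapDomain`; tree: `prime_det_of_X`,
`coeff_permMonomial_detPoly`, `permMonomial_apply`, `intCast_sign_ne_zero` (`DeterminantIrreducible`).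
-/

noncomputable section

namespace Literature.Computability.AlgebraicComplexity

open MvPolynomial

/-! ### Divisibility by the determinant -/

section DetDivides

variable {k : Type*} [Field k] {α : Type*} [DecidableEq α]

/-- **Divisibility by the determinant.** Over an infinite field, let `ι` place a `(d+1) × (d+1)`
matrix of distinct variables `Y = (x_{ι(i,j)})` in `k[x_α]`, and let `P ∈ k[x_α]` vanish at every
point whose `Y`-matrix is singular. Then `det Y ∣ P`.
Proof: expand `det Y = y₀ C + E` along the first row (`y₀ = x_{ι(0,0)}`, `C` the cofactor, `C, E`
free of `y₀`), read `P` as a polynomial `p(y₀)` over `R = k[x_β]` (`β = α ∖ {y₀}`) and put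
`H = p.scaleRoots C` (`H(C y₀) = C^N p(y₀)`). At a point `z` with `C(z) ≠ 0` the point
`y₀ = -E(z)/C(z)` is singular, so `p_z(-E(z)/C(z)) = 0`, i.e. `H(-E)(z) = 0`; hence
`H(-E) · C` vanishes identically, `H(-E) = 0`, `(y₀ + E) ∣ H`, and substituting `y₀ ↦ C y₀` gives
`det Y ∣ C^N P`; conclude by primality of `det Y` (`prime_det_of_X`) and `det Y ∤ C` (degree in
`y₀`). [folklore] -/
theorem det_dvd_of_forall_eval_eq_zero [Infinite k] {d : ℕ} {ι : Fin (d + 1) × Fin (d + 1) → α}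
    (hι : Function.Injective ι) {P : MvPolynomial α k}
    (hP : ∀ x : α → k, (Matrix.of fun i j => x (ι (i, j))).det = 0 → eval x P = 0) :
    (Matrix.of fun i j => (X (ι (i, j)) : MvPolynomial α k)).det ∣ P := by
  classical
  -- notation
  set y₀ : α := ι (0, 0) with hy₀
  set Yv : Matrix (Fin (d + 1)) (Fin (d + 1)) (MvPolynomial α k) :=
    Matrix.of fun i j => X (ι (i, j)) with hYv
  let β : Type _ := {b : α // b ≠ y₀}
  have hne : ∀ (i : Fin d) (j : Fin (d + 1)), ι (i.succ, j) ≠ y₀ := fun i j h =>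
    Fin.succ_ne_zero i (congrArg Prod.fst (hι h))
  have hne' : ∀ j : Fin d, ι (0, j.succ) ≠ y₀ := fun j h =>
    Fin.succ_ne_zero j (congrArg Prod.snd (hι h))
  -- the cofactor `C` and the rest `E`, over `β`
  set c' : MvPolynomial β k :=
    (Matrix.of fun i j : Fin d => (X ⟨ι (i.succ, j.succ), hne i _⟩ : MvPolynomial β k)).det with hc'
  set e' : MvPolynomial β k := ∑ j : Fin d, (-1) ^ ((j.succ : Fin (d + 1)) : ℕ) *
    (X ⟨ι (0, j.succ), hne' j⟩ : MvPolynomial β k) *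
      (Matrix.of fun i l : Fin d =>
        (X ⟨ι (i.succ, j.succ.succAbove l), hne i _⟩ : MvPolynomial β k)).det with he'
  set emb : β → α := Subtype.val with hemb
  -- the Laplace expansion along the first row
  have hsub0 : Yv.submatrix Fin.succ Fin.succ =
      (Matrix.of fun i j : Fin d => (X ⟨ι (i.succ, j.succ), hne i _⟩ : MvPolynomial β k)).map
        (rename emb) := by
    ext i j : 2
    simp [hYv, hemb]
  have hsubj : ∀ j : Fin d, Yv.submatrix Fin.succ (j.succ.succAbove) =
      (Matrix.of fun i l : Fin d =>
        (X ⟨ι (i.succ, j.succ.succAbove l), hne i _⟩ : MvPolynomial β k)).map (rename emb) := by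
    intro j
    ext i l : 2
    simp [hYv, hemb]
  have hdecomp : Yv.det = X y₀ * rename emb c' + rename emb e' := by
    rw [Matrix.det_succ_row_zero, Fin.sum_univ_succ]
    congr 1
    · rw [hc', AlgHom.map_det, AlgHom.mapMatrix_apply, ← hsub0, Fin.succAbove_zero]
      simp [hYv, hy₀]
    · rw [he', map_sum]
      refine Finset.sum_congr rfl fun j _ => ?_
      rw [map_mul, map_mul, AlgHom.map_det, AlgHom.mapMatrix_apply, ← hsubj j, map_pow, map_neg,
        map_one, rename_X]
      simp [hYv, hemb]
  -- `c' ≠ 0`: evaluate at the "identity" point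
  have hc'0 : c' ≠ 0 := by
    intro h0
    have h := congrArg (eval fun b : β => if ∃ i : Fin d, b.1 = ι (i.succ, i.succ) then (1 : k) else 0) h0
    rw [map_zero, hc', RingHom.map_det, RingHom.mapMatrix_apply] at h
    have hmat : (Matrix.of fun i j : Fin d => (X ⟨ι (i.succ, j.succ), hne i _⟩ : MvPolynomial β k)).map
        (eval fun b : β => if ∃ i : Fin d, b.1 = ι (i.succ, i.succ) then (1 : k) else 0) = 1 := by
      ext i j
      simp only [Matrix.map_apply, Matrix.of_apply, eval_X, Matrix.one_apply]
      by_cases hij : i = j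
      · subst hij
        rw [if_pos ⟨i, rfl⟩, if_pos rfl]
      · rw [if_neg, if_neg hij]
        rintro ⟨i', hi'⟩
        have := hι hi'
        simp only [Prod.mk.injEq, Fin.succ_inj] at this
        exact hij (this.1.trans this.2.symm)
    rw [hmat, Matrix.det_one] at h
    exact one_ne_zero h
  -- read `k[x_α]` as polynomials in `y₀` over `R = k[x_β]`
  set eo : Option β ≃ α := Equiv.optionSubtypeNe y₀ with heo
  set ψ : MvPolynomial α k ≃ₐ[k] Polynomial (MvPolynomial β k) :=
    (renameEquiv k eo.symm).trans (optionEquivLeft k β) with hψ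
  have hψX : ψ (X y₀) = Polynomial.X := by
    rw [hψ, AlgEquiv.trans_apply, renameEquiv_apply, rename_X, heo, Equiv.optionSubtypeNe_symm_self,
      optionEquivLeft_X_none]
  have hψC : ∀ q : MvPolynomial β k, ψ (rename emb q) = Polynomial.C q := by
    intro q
    have h : (ψ.toAlgHom.comp (rename emb)) = IsScalarTower.toAlgHom k (MvPolynomial β k)
        (Polynomial (MvPolynomial β k)) := by
      apply MvPolynomial.algHom_ext
      intro b
      simp [hψ, renameEquiv_apply, rename_X, heo, hemb, Equiv.optionSubtypeNe_symm_of_ne b.2,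
        optionEquivLeft_X_some]
    exact congrArg (fun φ : MvPolynomial β k →ₐ[k] Polynomial (MvPolynomial β k) => φ q) h
  have hψdet : ψ Yv.det = Polynomial.C c' * Polynomial.X + Polynomial.C e' := by
    rw [hdecomp, map_add, map_mul, hψX, hψC, hψC, mul_comm]
  -- evaluation through `ψ`
  have heval : ∀ (z : β → k) (y : k),
      eval (fun a => if h : a = y₀ then y else z ⟨a, h⟩) P =
        Polynomial.eval y (Polynomial.map (eval z) (ψ P)) := by
    intro z y
    have hx : (fun a => if h : a = y₀ then y else z ⟨a, h⟩) = (fun o : Option β => Option.elim o y z) ∘ ⇑eo.symm := by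
      funext a
      by_cases h : a = y₀
      · rw [dif_pos h, Function.comp_apply, h, heo, Equiv.optionSubtypeNe_symm_self]
        rfl
      · rw [dif_neg h, Function.comp_apply, heo, Equiv.optionSubtypeNe_symm_of_ne h]
        rfl
    rw [hx, ← eval_rename, optionEquivLeft_elim_eval]
    rfl
  -- the scaled polynomial `H` and its value at `-e'`
  set p : Polynomial (MvPolynomial β k) := ψ P with hp
  set H : Polynomial (MvPolynomial β k) := p.scaleRoots c' with hH
  have hroot : H.eval (-e') = 0 := by
    -- `H(-e') · c'` vanishes at every point
    have hfun : H.eval (-e') * c' = 0 := by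
      apply MvPolynomial.funext
      intro z
      rw [map_mul, map_zero]
      by_cases hcz : eval z c' = 0
      · rw [hcz, mul_zero]
      · -- the singular point `y₀ = -e'(z)/c'(z)`
        set y : k := -(eval z e') / eval z c' with hy
        have hsing : eval (fun a => if h : a = y₀ then y else z ⟨a, h⟩) P = 0 := by
          apply hP
          have : (Matrix.of fun i j => (fun a => if h : a = y₀ then y else z ⟨a, h⟩) (ι (i, j))).det =
              eval (fun a => if h : a = y₀ then y else z ⟨a, h⟩) Yv.det := by
            rw [RingHom.map_det, RingHom.mapMatrix_apply]
            congr 1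
            ext i j
            simp [hYv]
          rw [this, hdecomp, map_add, map_mul, eval_X, eval_rename, eval_rename, dif_pos rfl]
          have h1 : ((fun a => if h : a = y₀ then y else z ⟨a, h⟩) ∘ emb) = z := by
            funext b; simp [hemb, b.2]
          rw [h1, hy]
          field_simp
          ring
        rw [heval] at hsing
        -- `H(-e')(z) = c'(z)^N · p_z(y) = 0`
        have key := Polynomial.scaleRoots_eval₂_mul (p := p) (eval z) y c'
        rw [Polynomial.eval₂_eq_eval_map, Polynomial.eval₂_eq_eval_map, hsing, mul_zero] at key
        have hcy : eval z c' * y = eval z (-e') := by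
          rw [hy, map_neg]; field_simp
        rw [hcy, ← hH] at key
        rw [Polynomial.eval_map, Polynomial.eval₂_hom] at key
        rw [key, zero_mul]
    exact (mul_eq_zero.mp hfun).resolve_right hc'0
  -- factor `H = (X + e') G` and substitute `X ↦ c' X`
  obtain ⟨G, hG⟩ : (Polynomial.X - Polynomial.C (-e')) ∣ H := Polynomial.dvd_iff_isRoot.mpr hroot
  have hcomp : H.comp (Polynomial.C c' * Polynomial.X) = Polynomial.C c' ^ p.natDegree * p := by
    rw [hH, Polynomial.comp, Polynomial.scaleRoots_eval₂_mul, Polynomial.eval₂_C_X]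
  have hfactor : Polynomial.C c' ^ p.natDegree * p =
      ψ Yv.det * G.comp (Polynomial.C c' * Polynomial.X) := by
    rw [← hcomp, hG, Polynomial.mul_comp, Polynomial.sub_comp, Polynomial.X_comp,
      Polynomial.C_comp, hψdet, map_neg, sub_neg_eq_add]
  -- back in `k[x_α]`: `det Y ∣ C^N P`
  have hdvd : Yv.det ∣ rename emb c' ^ p.natDegree * P := by
    refine ⟨ψ.symm (G.comp (Polynomial.C c' * Polynomial.X)), ψ.injective ?_⟩
    rw [map_mul, map_mul, map_pow, hψC, ψ.apply_symm_apply, ← hp]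
    exact hfactor
  -- `det Y` is prime and does not divide the cofactor
  have hprime : Prime Yv.det := prime_det_of_X hι
  rcases hprime.dvd_or_dvd hdvd with h | h
  · exfalso
    have hC : Yv.det ∣ rename emb c' := hprime.dvd_of_dvd_pow h
    -- degree in `y₀`: `≥ 1` for `det Y`, `= 0` for the cofactor
    have hdeg0 : degreeOf y₀ (rename emb c') = 0 := by
      by_contra h0
      obtain ⟨b, -, hb⟩ := mem_vars_rename _ _ (mem_vars_iff_degreeOf_ne_zero.mpr h0)
      exact b.2 hb
    have hdeg1 : 1 ≤ degreeOf y₀ Yv.det := by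
      have hdet : Yv.det = rename ι (detPoly (Fin (d + 1)) k) := by
        rw [detPoly, AlgHom.map_det]
        congr 1
        ext i j
        simp [hYv, AlgHom.mapMatrix_apply, Matrix.map_apply, Matrix.mvPolynomialX_apply, rename_X]
      have hmem : Finsupp.mapDomain ι (permMonomial (1 : Equiv.Perm (Fin (d + 1)))) ∈ Yv.det.support := by
        rw [mem_support_iff, hdet, coeff_rename_mapDomain ι hι, coeff_permMonomial_detPoly]
        exact intCast_sign_ne_zero k 1
      have := monomial_le_degreeOf y₀ hmem
      rwa [hy₀, Finsupp.mapDomain_apply hι, permMonomial_apply, Equiv.Perm.one_apply, if_pos rfl] at this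
    obtain ⟨G', hG'⟩ := hC
    have hG'0 : G' ≠ 0 := by
      rintro rfl
      rw [mul_zero] at hG'
      exact (rename_injective emb Subtype.val_injective).ne hc'0 (by rw [hG', map_zero])
    have := degreeOf_mul_eq (n := y₀) hprime.ne_zero hG'0
    rw [← hG', hdeg0] at this
    omega
  · exact h

end DetDivides


end Literature.Computability.AlgebraicComplexity
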